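import Literature.Probability.LatticeModels.KCTwoPointSupBound
import Literature.Probability.LatticeModels.GKSInequalities
import HarnessLib

/-!
# Positivity of the magnetisation-type constant `S₀(δ) = 𝔼⁺[σ_{v₀} σ_{b̂}]` of the two-point family

Topic `Literature/Probability/LatticeModels`. The normaliser `N_δ = S₀(δ)² + 𝓜_δ(R₀)` of the
renormalised analysis of the two-point family (`KCTwoPointSupBound.lean`, Chelkak–Hongler–Izyurov
2015, §3.4) is positive because the spin correlation `S₀(δ) = 𝔼⁺_{Λ_δ}[σ_{v₀} σ_{b̂}]` is: by
Griffiths' comparison of boundary conditions (`isingCorr_le_isingCorr_plus`, Friedli–Velenik 2017,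
Exercise 3.31) it dominates the free correlation, which by the high-temperature expansion
(`isingCorr_free_eq_hteSum_div`, Duminil-Copin 2016, §2.2.1) is a ratio of sums of `tanh(β)^{|F|}` over
edge sets with prescribed odd vertices — and the edges of a simple path from `v₀` to `b̂` inside the
(connected) component volume form such a set (`hteSum_pair_pos_of_isPath`).

* `hteSum_pair_pos_of_isPath`, `isingCorr_free_pair_pos_of_reachable`;
* **`srcMag0_pos`**, **`eventually_srcMag0_pos`** (whence the hypothesis `hS` of
  `KCTwoPointSupBound.apriori_bound`).

Everything is proved; no named fact.

## References

* D. Chelkak, C. Hongler, K. Izyurov, Ann. of Math. 181 (2015), Def. 2.1 (normalisation by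
  `E[σ_a σ_b]`) [ChelkakHonglerIzyurovAnnals2015].
* H. Duminil-Copin, lectures on the Ising model, ECM 2016, §2.2.1 [DuminilCopinECM2018].
* S. Friedli, Y. Velenik, *Statistical Mechanics of Lattice Systems* (2017), Exercise 3.31
  [FriedliVelenik2017].
-/

noncomputable section

namespace Literature.Probability.LatticeModels

open Complex Filter Metric Set _root_.Topology Finset SimpleGraph WeakBeurling
open scoped symmDiff

variable {Ω : Set ℂ} {a b : ℂ}

/-! ### A path carries a term of the high-temperature expansion -/

/-- **The edges of a simple path from `x` to `y` inside `Λ` have odd vertices exactly `{x, y}`**, so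
`g_Λ({x, y}) ≥ t^{|path|} > 0` for `t > 0`. [cite: DuminilCopinECM2018, §2.2.1] -/
theorem hteSum_pair_pos_of_isPath (G : SimpleGraph (Site 2)) [G.LocallyFinite] {Λ : Finset (Site 2)} {t : ℝ} (ht : 0 < t)
    {x y : Site 2} (hxy : x ≠ y) (p : G.Walk x y) (hp : p.IsPath) (hsupp : ∀ v ∈ p.support, v ∈ Λ) :
    0 < hteSum G Λ t {x, y} := by
  classical
  have hnodup : p.edges.Nodup := hp.isTrail.edges_nodup
  set F : Finset (Sym2 (Site 2)) := p.edges.toFinset with hF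
  -- `F ⊆ ℰ_Λ`
  have hFsub : F ⊆ edgesIn G Λ := by
    intro e he
    rw [hF, List.mem_toFinset] at he
    rw [mem_edgesIn_iff]
    refine ⟨p.edges_subset_edgeSet he, fun v hv => hsupp v ?_⟩
    induction e using Sym2.ind with
    | _ u w =>
      rcases Sym2.mem_iff.1 hv with rfl | rfl
      · exact p.fst_mem_support_of_mem_edges he
      · exact p.snd_mem_support_of_mem_edges he
  -- the degrees
  have hdeg : ∀ v, #(F.filter fun e => v ∈ e) = p.edges.countP fun e => v ∈ e := by
    intro v
    have hset : F.filter (fun e => v ∈ e) = (p.edges.filter fun e => decide (v ∈ e)).toFinset := by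
      ext z; simp [hF]
    rw [hset, List.toFinset_card_of_nodup (hnodup.filter _), List.countP_eq_length_filter]
  have hodd : oddVerts Λ F = {x, y} := by
    ext v
    rw [oddVerts, mem_filter, hdeg, ← Nat.not_even_iff_odd, hp.isTrail.even_countP_edges_iff v, Finset.mem_insert,
      Finset.mem_singleton]
    constructor
    · rintro ⟨-, hne⟩
      by_contra hv
      exact hne fun _ => ⟨fun h1 => hv (Or.inl h1), fun h2 => hv (Or.inr h2)⟩
    · rintro (rfl | rfl)
      · exact ⟨hsupp _ p.start_mem_support, fun himp => (himp hxy).1 rfl⟩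
      · exact ⟨hsupp _ p.end_mem_support, fun himp => (himp hxy).2 rfl⟩
  -- one positive term
  have hmem : F ∈ (edgesIn G Λ).powerset.filter fun F' => oddVerts Λ F' = {x, y} :=
    mem_filter.2 ⟨mem_powerset.2 hFsub, hodd⟩
  calc (0 : ℝ) < t ^ #F := pow_pos ht _
    _ ≤ hteSum G Λ t {x, y} := by
        rw [hteSum]
        exact Finset.single_le_sum (f := fun F' => t ^ #F') (fun F' _ => pow_nonneg ht.le _) hmem

/-- **The free two-point function of two points joined inside `Λ` is positive** (`β > 0`). [cite: DuminilCopinECM2018, §2.2.1] -/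
theorem isingCorr_free_pair_pos_of_isPath (G : SimpleGraph (Site 2)) [G.LocallyFinite] {Λ : Finset (Site 2)} {β : ℝ}
    (hβ : 0 < β) {x y : Site 2} (hxy : x ≠ y) (p : G.Walk x y) (hp : p.IsPath) (hsupp : ∀ v ∈ p.support, v ∈ Λ) :
    0 < isingCorr G Λ β 0 .free {x, y} := by
  have hx : x ∈ Λ := hsupp _ p.start_mem_support
  have hy : y ∈ Λ := hsupp _ p.end_mem_support
  have hA : ({x, y} : Finset (Site 2)) ⊆ Λ := by
    intro v hv
    rcases Finset.mem_insert.1 hv with rfl | hv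
    · exact hx
    · rw [Finset.mem_singleton.1 hv]; exact hy
  have ht : 0 < Real.tanh β := by
    rw [Real.tanh_eq_sinh_div_cosh]; exact div_pos (Real.sinh_pos_iff.2 hβ) (Real.cosh_pos β)
  rw [isingCorr_free_eq_hteSum_div G Λ β hA]
  exact div_pos (hteSum_pair_pos_of_isPath G ht hxy p hp hsupp) (hteSum_empty_pos G Λ β)

/-! ### The constant `S₀(δ)` -/

/-- **`S₀(δ) > 0`** as soon as the source site `v₀ = p₀ + e₀ + e₁` and the background site `b̂` are
sites of the (connected) component volume. [cite: ChelkakHonglerIzyurovAnnals2015, Def. 2.1; FriedliVelenik2017, Exercise 3.31] -/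
theorem srcMag0_pos {δ : ℝ} (hv : sourcePlaq δ a + cornerUnit 0 + cornerUnit 1 ∈ compVol Ω a δ)
    (hb : nearestSite δ b ∈ compVol Ω a δ) : 0 < srcMag0 Ω a b δ := by
  classical
  set G := discreteDomainGraph Ω δ
  set Λ := compVol Ω a δ
  set v₀ := sourcePlaq δ a + cornerUnit 0 + cornerUnit 1 with hv₀
  set bh := nearestSite δ b with hbh
  have hσ : kcSigma {bh} v₀ ∅ = 1 := by simp [kcSigma, leftCount]
  rw [srcMag0, kcS, hσ, one_mul]
  by_cases hvb : v₀ ∈ ({bh} : Finset (Site 2))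
  · rw [kcCorner_empty_of_mem _ _ _ _ hvb]
    have : ({bh} : Finset (Site 2)).erase v₀ = ∅ := by
      rw [Finset.mem_singleton.1 hvb, Finset.erase_singleton]
    rw [this, isingCorr]
    have h1 : spinProduct (∅ : Finset (Site 2)) = fun _ : SpinConfig (Site 2) => (1 : ℝ) := funext fun σ => by simp [spinProduct]
    rw [h1, isingExpect_const]; exact one_pos
  · rw [kcCorner_empty_of_notMem _ _ _ _ hvb]
    have hne : v₀ ≠ bh := fun h => hvb (Finset.mem_singleton.2 h)
    -- a simple path from `v₀` to `b̂` in `G` inside `Λ`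
    set H := G.induce (↑Λ : Set (Site 2)) with hH
    have hle : (zdGraph 2).induce (↑Λ : Set (Site 2)) ≤ H := by
      rintro ⟨x, hx⟩ ⟨y, hy⟩ hxy
      rw [SimpleGraph.comap_adj] at hxy ⊢
      obtain ⟨k, rfl⟩ := exists_eq_add_cornerUnit_of_adj hxy
      exact compVol_adj (Finset.mem_coe.1 hx) k
    have hreach : H.Reachable ⟨v₀, Finset.mem_coe.2 hv⟩ ⟨bh, Finset.mem_coe.2 hb⟩ :=
      (compVol_preconnected.mono hle) _ _
    obtain ⟨q, hq⟩ : ∃ q : H.Walk ⟨v₀, Finset.mem_coe.2 hv⟩ ⟨bh, Finset.mem_coe.2 hb⟩, q.IsPath :=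
      hreach.elim_path fun q => ⟨q.1, q.2⟩
    set φ : H →g G := (SimpleGraph.Embedding.induce (↑Λ : Set (Site 2))).toHom with hφ
    have hφinj : Function.Injective φ := fun u w h => Subtype.ext h
    set p : G.Walk v₀ bh := q.map φ with hp
    have hpath : p.IsPath := Walk.IsPath.map hφinj hq
    have hsupp : ∀ v ∈ p.support, v ∈ Λ := by
      intro v hv'
      have : v ∈ (q.map φ).support := hv'
      rw [Walk.support_map, List.mem_map] at this
      obtain ⟨u, -, rfl⟩ := this
      exact Finset.mem_coe.1 u.2
    have hpos := isingCorr_free_pair_pos_of_isPath G criticalBetaTwo_pos hne p hpath hsupp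
    have hA : ({v₀, bh} : Finset (Site 2)) ⊆ Λ := by
      intro v hv'
      rcases Finset.mem_insert.1 hv' with rfl | hv'
      · exact hv
      · rw [Finset.mem_singleton.1 hv']; exact hb
    have hcmp := isingCorr_le_isingCorr_plus G criticalBetaTwo_pos.le le_rfl .free hA
    exact lt_of_lt_of_le hpos hcmp

/-- The source site of the family is `nearestSite δ a`: `p₀ + e₀ + e₁ = [a/δ]`. [folklore] -/
theorem sourcePlaq_add_eq_nearestSite (δ : ℝ) (a : ℂ) : sourcePlaq δ a + cornerUnit 0 + cornerUnit 1 = nearestSite δ a := by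
  rw [sourcePlaq_eq_faceAt, faceAt]
  ext i; fin_cases i <;> simp [cornerOff, cornerUnit]

/-- **`S₀(δ) > 0` for all small `δ`.** [cite: ChelkakHonglerIzyurovAnnals2015, Def. 2.1] -/
theorem eventually_srcMag0_pos (hΩo : IsOpen Ω) (hΩc : IsConnected Ω) (hM : MeshApproximates Ω) (ha : a ∈ Ω) (hb : b ∈ Ω)
    (hHF : ∀ᶠ δ in 𝓝[>] (0 : ℝ), HoleFree (↑(meshInteriorFinset Ω δ) : Set (Site 2))) :
    ∀ᶠ δ in 𝓝[>] (0 : ℝ), 0 < srcMag0 Ω a b δ := by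
  obtain ⟨ρ, hρ, hρΩ⟩ := Metric.isOpen_iff.1 hΩo b hb
  have hball : closedBall b (ρ / 2) ⊆ Ω := fun z hz => hρΩ (mem_ball.2 (lt_of_le_of_lt (mem_closedBall.1 hz) (by linarith)))
  have hδρ : ∀ᶠ δ in 𝓝[>] (0 : ℝ), δ ≤ ρ / 2 := mem_nhdsWithin_of_mem_nhds (Iic_mem_nhds (by positivity))
  filter_upwards [eventually_goodScale hΩo hM ha hHF, eventually_ball_subset_compVol hΩo hΩc hM ha hball, hδρ,
    self_mem_nhdsWithin] with δ hgood hbulk hδρ hδ0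
  have hδ0 : (0 : ℝ) < δ := hδ0
  refine srcMag0_pos ?_ (hbulk _ ((dist_meshPoint_nearestSite_le hδ0 b).trans hδρ))
  rw [sourcePlaq_add_eq_nearestSite]
  exact nearestSite_mem_compVol hgood.2

end Literature.Probability.LatticeModels
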